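import Summits.AtomisticToContinuum.Crystallization.Theorems.ContactSaturationLadderCompetitorGrade

/-!
# Route `ContactSaturationLadder`, item `LooseTextureRung` (stmt-AtomisticToContinuum-30303): the competitor grade `γ = 5/7` — part 2: shell structure, distances, Lennard-Jones values, the dilated trial state

Continuation of `ContactSaturationLadderCompetitorGrade` (lens-1 g36 file `ContactSaturationLadderCompetitorGrade.lean`, sha256 1895364dc235fe8e…,
split at landing by hand-2 g10 under the gate's ≤ 400-line rule; same namespace, declarations byte-identical).
-/

noncomputable section

open scoped BigOperators Topology
open Filter Set Metric

namespace Summit.AtomisticToContinuum.Crystallization.Theorems.ContactSaturationLadderCompetitorGrade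

open Literature.MathematicalPhysics.StatisticalMechanics
open Summit.AtomisticToContinuum.Crystallization.Theorems.MieRungEnergetic

/-- The shell structure of `fccShells`: the Gram form takes the value `n` exactly `c_n` times,
`(c_1, …, c_36) = (12, 6, 24, 12, 24, 8, 48, 6, 36, 24, 24, 24, 72, 0, 48, 12, 48, 30, 72, 24, 48, 24, 48, 8, 84, 24, 96, 48, 24, 0, 96, 6, 96, 48, 48, 36)` (kernel check). [folklore] -/
theorem map_fccGram_fccShells :
    fccShells.map fccGram =
      List.replicate 12 (1 : ℤ) ++
    List.replicate 6 (2 : ℤ) ++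
    List.replicate 24 (3 : ℤ) ++
    List.replicate 12 (4 : ℤ) ++
    List.replicate 24 (5 : ℤ) ++
    List.replicate 8 (6 : ℤ) ++
    List.replicate 48 (7 : ℤ) ++
    List.replicate 6 (8 : ℤ) ++
    List.replicate 36 (9 : ℤ) ++
    List.replicate 24 (10 : ℤ) ++
    List.replicate 24 (11 : ℤ) ++
    List.replicate 24 (12 : ℤ) ++
    List.replicate 72 (13 : ℤ) ++
    List.replicate 48 (15 : ℤ) ++
    List.replicate 12 (16 : ℤ) ++
    List.replicate 48 (17 : ℤ) ++
    List.replicate 30 (18 : ℤ) ++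
    List.replicate 72 (19 : ℤ) ++
    List.replicate 24 (20 : ℤ) ++
    List.replicate 48 (21 : ℤ) ++
    List.replicate 24 (22 : ℤ) ++
    List.replicate 48 (23 : ℤ) ++
    List.replicate 8 (24 : ℤ) ++
    List.replicate 84 (25 : ℤ) ++
    List.replicate 24 (26 : ℤ) ++
    List.replicate 96 (27 : ℤ) ++
    List.replicate 48 (28 : ℤ) ++
    List.replicate 24 (29 : ℤ) ++
    List.replicate 96 (31 : ℤ) ++
    List.replicate 6 (32 : ℤ) ++
    List.replicate 96 (33 : ℤ) ++
    List.replicate 48 (34 : ℤ) ++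
    List.replicate 48 (35 : ℤ) ++
    List.replicate 36 (36 : ℤ) := by
  decide +kernel

/-- An integer sort key, strictly increasing along `fccShells` (shell value, then the site
lexicographically); used only to certify that the listed sites are pairwise distinct in linear
time. [folklore] -/
def fccKey (t : ℤ × ℤ × ℤ) : ℤ :=
  fccGram t * 65536 + (t.1 + 16) * 1024 + (t.2.1 + 16) * 32 + (t.2.2 + 16)

/-- The sort key is strictly increasing along `fccShells` (kernel check). [folklore] -/
theorem isChain_map_fccKey_fccShells : (fccShells.map fccKey).IsChain (· < ·) := by
  decide +kernel

/-- The listed sites are pairwise distinct. [folklore] -/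
theorem fccShells_nodup : fccShells.Nodup :=
  (List.isChain_iff_pairwise.1 isChain_map_fccKey_fccShells).nodup.of_map _

/-- The origin site is not listed (kernel check). [folklore] -/
theorem zero_not_mem_fccShells : ((0 : ℤ), (0 : ℤ), (0 : ℤ)) ∉ fccShells := by
  decide +kernel

/-! ### Distances in the ideal fcc stacking -/

/-- **`dist² = a²·G`**: in the fcc stacking with ideal layer spacing `h² = ⅔a²`, the squared
distance from the site `(0,0,0)` to the site `(k,i,j)` is `a² (k² + i² + j² + ki + ij + jk)`.
[folklore] -/
theorem dist_sq_eq_fccGram {a h : ℝ} (hh : h ^ 2 = 2 / 3 * a ^ 2) (k i j : ℤ) :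
    dist (barlowPos a h constHagg ((0 : ℕ) : ℤ) 0 0) (barlowPos a h constHagg k i j) ^ 2 =
      a ^ 2 * (fccGram (k, i, j) : ℝ) := by
  have h12 := twelve_mul_dist_barlowPos_sq hh constHagg ((0 : ℕ) : ℤ) 0 0 k i j
  simp only [haggLabel_const, fccGram] at h12 ⊢
  push_cast at h12 ⊢
  linear_combination (1 / 12 : ℝ) * h12

/-- Distinct sites of the ideal stacking are distinct points (they are at distance `≥ a > 0`,
`le_dist_barlowPos_of_ideal`). [folklore] -/
theorem barlowPos_ne_of_ne {a h : ℝ} (ha : 0 < a) (hh : h ^ 2 = 2 / 3 * a ^ 2)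
    {k i j k' i' j' : ℤ} (hne : (k, i, j) ≠ (k', i', j')) :
    barlowPos a h constHagg k i j ≠ barlowPos a h constHagg k' i' j' := by
  intro heq
  have hle := le_dist_barlowPos_of_ideal isHaggSeq_const ha hh hne
  rw [heq, dist_self] at hle
  exact absurd hle (not_le.2 ha)

/-! ### Lennard-Jones values -/

/-- `V_LJ` through the squared distance: `V(d) = x⁻⁶/12 − x⁻³/6` for `d ≥ 0`, `d² = x`.
[folklore] -/
theorem miePotential_six_eq_of_sq {d x : ℝ} (hx : d ^ 2 = x) :
    miePotential 6 d = 1 / 12 * x⁻¹ ^ 6 - 1 / 6 * x⁻¹ ^ 3 := by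
  rw [miePotential_apply, ← hx]
  push_cast
  ring

/-- `V_LJ(d) ≤ 0` as soon as `d² ≥ 19/20` (indeed as soon as `d⁶ ≥ 1/2`). [folklore] -/
theorem miePotential_six_nonpos_of_sq_ge {d : ℝ} (hd : 0 < d) (hx : 19 / 20 ≤ d ^ 2) :
    miePotential 6 d ≤ 0 := by
  rw [miePotential_six_eq_of_sq rfl]
  have hx0 : 0 < d ^ 2 := by positivity
  have hinv : (d ^ 2)⁻¹ ≤ 20 / 19 := by
    rw [inv_le_comm₀ hx0 (by norm_num)]
    linarith
  have hinv0 : 0 ≤ (d ^ 2)⁻¹ := by positivity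
  have h3 : (d ^ 2)⁻¹ ^ 3 ≤ (20 / 19 : ℝ) ^ 3 := pow_le_pow_left₀ hinv0 hinv 3
  have h6 : (d ^ 2)⁻¹ ^ 6 = ((d ^ 2)⁻¹ ^ 3) ^ 2 := by ring
  rw [h6]
  nlinarith [pow_nonneg hinv0 3]

/-! ### The dilated fcc trial state -/

/-- `√(19/20) ≠ 0`. [folklore] -/
theorem sqrt_a_ne_zero : Real.sqrt (19 / 20) ≠ 0 := (Real.sqrt_pos.2 (by norm_num)).ne'

/-- `√(19/30) ≠ 0`. [folklore] -/
theorem sqrt_h_ne_zero : Real.sqrt (19 / 30) ≠ 0 := (Real.sqrt_pos.2 (by norm_num)).ne'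

/-- The layer spacing `h = √(19/30)` is ideal for `a = √(19/20)`: `h² = ⅔ a²`. [folklore] -/
theorem sqrt_h_sq : Real.sqrt (19 / 30) ^ 2 = 2 / 3 * Real.sqrt (19 / 20) ^ 2 := by
  rw [Real.sq_sqrt (by norm_num), Real.sq_sqrt (by norm_num)]; norm_num

/-- The motif of the dilated fcc configuration is the single origin site. [folklore] -/
theorem fccDilated_motif :
    (fccPeriodicConfiguration (a := Real.sqrt (19 / 20)) (h := Real.sqrt (19 / 30)) sqrt_a_ne_zero
        sqrt_h_ne_zero).motif =
      {barlowPos (Real.sqrt (19 / 20)) (Real.sqrt (19 / 30)) constHagg ((0 : ℕ) : ℤ) 0 0} := by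
  simp [fccPeriodicConfiguration, barlowPeriodicConfiguration]

/-- Its point set is the fcc stacking `barlowStacking √(19/20) √(19/30) constHagg`. [folklore] -/
theorem fccDilated_points :
    (fccPeriodicConfiguration (a := Real.sqrt (19 / 20)) (h := Real.sqrt (19 / 30)) sqrt_a_ne_zero
        sqrt_h_ne_zero).points =
      barlowStacking (Real.sqrt (19 / 20)) (Real.sqrt (19 / 30)) constHagg := by
  rw [fccPeriodicConfiguration_points]; rfl

end Summit.AtomisticToContinuum.Crystallization.Theorems.ContactSaturationLadderCompetitorGrade

end
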